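import Summits.QuantumAdvantage.AdviceFreeQNC0.UnionBoundLift
import Summits.QuantumAdvantage.AdviceFreeQNC0.AugmentedCodePatterns
import Summits.QuantumAdvantage.AdviceFreeQNC0.WindowDegree
import Summits.QuantumAdvantage.AdviceFreeQNC0.WalshModThree
import HarnessLib

/-!
# Cell qa-qnc0 (rung F-Q1, route RingFrame, crux α, line `tensor`): the block family of light coset
# leaders with full cover (planner qa-qnc0-p2 gen 4, `S1-REFUTED.md` THEOREM A)

Planner qa-qnc0-p2's explicit family refuting `UnionBound` / `LiftOneStrict` (S1) / `RankBound`
(HOME/qa-qnc0-p2/S1-REFUTED.md, asks N-1…N-3), in the coordinate-friendly instance `Q = R = 𝔽₂ⁿ`: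
`L = n` rows `u ∈ 𝔽₂ⁿ`, `L' = 2n` columns `v = (q, r) ∈ 𝔽₂ⁿ × 𝔽₂ⁿ`, blocks `B_q = {q} × 𝔽₂ⁿ`,
`λ(u) = {e_j : u_j = 1}`, LEADERS `a_u = B_u ∪ (B_0 ∖ λ(u))` (`u ≠ 0`; `ldr`), the matrix with LINEAR
COLUMNS `X(u, v) = Σ_j u_j a_{e_j}(v)` (`Xf`) and its row-wise decoding `Y = X + a` (`Yf`).

* `linCols_Xf : LinCols Xf`;
* `rowsDeg_Yf : RowsDeg (n − 2) Yf` — the COCYCLE IS A FLAT: `a_{u_T} + a_{e_i} + a_{u_T + e_i}` is the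
  indicator of `{0, u_T, e_i, u_T + e_i} × 𝔽₂ⁿ` (`ldr_triangle`), which is cut out by `n − 2` explicit
  AFFINE forms (`q_k = 0` off `T ∪ {i}`, `q_l = q_{k₁}` on `T`; `flat_eq`), hence has degree `≤ n − 2`
  (`hasDeg_flat`; no Reed–Muller duality or change of basis);
* `rowDist_le : rowDist Xf Yf u ≤ 2^{n+1} − 1` (`|a_u| = 2^{n+1} − |u|`, strictly inside the radius
  `2^{L'−d} = 2^{n+2}`), `colDiff_eq_univ : colDiff Xf Yf = univ` (`n ≥ 2`).

The refutations are in `UnionBoundRefutation.lean`.  WHAT THIS IS NOT: nothing on `LiftOneStrictLog`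
(S1', open and tight on this family per qn-p2), `TRPlus`, α or the separation.
-/

namespace Summit.QuantumAdvantage.AdviceFreeQNC0

namespace TensorBlock

open Finset
open Literature.Computability.MetaComplexity Literature.Computability.MetaComplexity.Smolensky

variable {n : ℕ}

/-! ### Coordinates and the family -/

/-- The `Q`-coordinates (first `n`) of a column index. -/
def qp (v : Fin (n + n) → Bool) : Fin n → Bool := fun i => v (Fin.castAdd n i)

/-- The `R`-coordinates (last `n`) of a column index. -/
def rp (v : Fin (n + n) → Bool) : Fin n → Bool := fun i => v (Fin.natAdd n i)

/-- The row `u_S = 1_S`. -/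
def ind (S : Finset (Fin n)) : Fin n → Bool := fun j => decide (j ∈ S)

/-- The coset leader `a_u = B_u ∪ (B_0 ∖ λ(u))` (`a_0 = 0`), as a Boolean row over the columns. -/
def ldr (u : Fin n → Bool) (v : Fin (n + n) → Bool) : Bool :=
  if u = (fun _ => false) then false
  else if qp v = u then true
  else if qp v = (fun _ => false) then !decide (∃ j, u j = true ∧ rp v = basisRow j)
  else false

/-- The matrix with linear columns `X(u, ·) = Σ_j u_j · a_{e_j}`. -/
def Xf (u : Fin n → Bool) (v : Fin (n + n) → Bool) : Bool :=
  decide ((univ.filter fun j : Fin n => (u j && ldr (basisRow j) v) = true).card % 2 = 1)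

/-- Its row-wise decoding `Y = X + a`. -/
def Yf (u : Fin n → Bool) (v : Fin (n + n) → Bool) : Bool := xor (Xf u v) (ldr u v)

/-! ### Elementary facts -/

/-- `e_i ≠ 0`. -/
theorem basisRow_ne_zero (i : Fin n) : basisRow i ≠ (fun _ => false) := fun h => by
  have := congrFun h i
  simp [basisRow] at this

/-- `e_i j = [j = i]`. -/
theorem basisRow_apply (i j : Fin n) : basisRow i j = decide (j = i) := rfl

/-- `e_i = e_j ↔ i = j`. -/
theorem basisRow_inj {i j : Fin n} (h : basisRow i = basisRow j) : i = j := by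
  have := congrFun h i
  simp [basisRow] at this
  exact this

/-- `u_T = 0 ↔ T = ∅`. -/
theorem ind_eq_zero_iff (T : Finset (Fin n)) : ind T = (fun _ => false) ↔ T = ∅ := by
  constructor
  · intro h
    rw [Finset.eq_empty_iff_forall_notMem]
    intro j hj
    have := congrFun h j
    simp [ind, hj] at this
  · rintro rfl; funext j; simp [ind]

/-- `u_T j = [j ∈ T]`. -/
theorem ind_apply (T : Finset (Fin n)) (j : Fin n) : ind T j = decide (j ∈ T) := rfl

/-- `a_0 = 0`. -/
theorem ldr_zero (v : Fin (n + n) → Bool) : ldr (fun _ => false) v = false := by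
  unfold ldr; rw [if_pos rfl]

/-- Off the zero block the leader `a_u` is the block `B_u`. -/
theorem ldr_of_qp_ne_zero {v : Fin (n + n) → Bool} (hq : qp v ≠ (fun _ => false)) (u : Fin n → Bool) :
    ldr u v = decide (qp v = u) := by
  unfold ldr
  by_cases hu : u = (fun _ => false)
  · rw [if_pos hu]; subst hu; simp [hq]
  · rw [if_neg hu]
    by_cases hqu : qp v = u
    · rw [if_pos hqu]; simp [hqu]
    · rw [if_neg hqu, if_neg hq]; simp [hqu]

/-- On the zero block the leader `a_u` (`u ≠ 0`) is the complement of `λ(u)`. -/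
theorem ldr_of_qp_eq_zero {v : Fin (n + n) → Bool} (hq : qp v = (fun _ => false)) {u : Fin n → Bool}
    (hu : u ≠ (fun _ => false)) : ldr u v = !decide (∃ j, u j = true ∧ rp v = basisRow j) := by
  unfold ldr
  rw [if_neg hu, if_neg (fun h => hu (h.symm.trans hq)), if_pos hq]

/-- `X(u_S, v) = ⟨1_S, (a_{e_j}(v))_j⟩`. -/
theorem Xf_ind (S : Finset (Fin n)) (v : Fin (n + n) → Bool) :
    Xf (ind S) v = CubeChar.subsetPar S (fun j => ldr (basisRow j) v) := by
  unfold Xf CubeChar.subsetPar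
  have h : (univ.filter fun j : Fin n => (ind S j && ldr (basisRow j) v) = true) =
      S.filter fun j => ldr (basisRow j) v = true := by
    ext j; simp [ind]
  rw [h]

/-- Linearity step of `X` along the rows `u_S`. -/
theorem Xf_ind_insert {T : Finset (Fin n)} {i : Fin n} (hi : i ∉ T) (v : Fin (n + n) → Bool) :
    Xf (ind (insert i T)) v = xor (ldr (basisRow i) v) (Xf (ind T) v) := by
  rw [Xf_ind, Xf_ind, CubeChar.subsetPar_insert hi]

/-! ### The cocycle is a flat -/

/-- **`a_{u_T} + a_{e_i} + a_{u_T+e_i} = 1_{{0, u_T, e_i, u_T+e_i} × R}`** (`T ≠ ∅`, `i ∉ T`). -/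
theorem ldr_triangle {T : Finset (Fin n)} (hT : T.Nonempty) {i : Fin n} (hi : i ∉ T)
    (v : Fin (n + n) → Bool) :
    xor (ldr (ind T) v) (xor (ldr (basisRow i) v) (ldr (ind (insert i T)) v)) =
      decide (qp v = (fun _ => false) ∨ qp v = ind T ∨ qp v = basisRow i ∨ qp v = ind (insert i T)) := by
  have hT0 : ind T ≠ (fun _ => false) := fun h => hT.ne_empty ((ind_eq_zero_iff T).1 h)
  have hS0 : ind (insert i T) ≠ (fun _ => false) := fun h =>
    (Finset.insert_ne_empty i T) ((ind_eq_zero_iff _).1 h)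
  -- the three rows are pairwise distinct
  have hTi : ind T ≠ basisRow i := fun h => by
    have := congrFun h i; simp [ind, basisRow, hi] at this
  have hTS : ind T ≠ ind (insert i T) := fun h => by
    have := congrFun h i; simp [ind, hi] at this
  have hiS : basisRow i ≠ ind (insert i T) := fun h => by
    obtain ⟨j, hj⟩ := hT
    have hji : j ≠ i := fun e => hi (e ▸ hj)
    have := congrFun h j; simp [ind, basisRow, hj, hji] at this
  by_cases hq : qp v = (fun _ => false)
  · -- the zero block: complements of `λ`, and `λ(u_T + e_i) = λ(u_T) ⊔ λ(e_i)`
    rw [ldr_of_qp_eq_zero hq hT0, ldr_of_qp_eq_zero hq (basisRow_ne_zero i), ldr_of_qp_eq_zero hq hS0]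
    have hA : (∃ j, basisRow i j = true ∧ rp v = basisRow j) ↔ rp v = basisRow i := by
      constructor
      · rintro ⟨j, hj, hr⟩
        have : j = i := by simpa [basisRow] using hj
        rw [hr, this]
      · intro hr; exact ⟨i, by simp [basisRow], hr⟩
    have hB : (∃ j, ind (insert i T) j = true ∧ rp v = basisRow j) ↔
        (rp v = basisRow i ∨ ∃ j, ind T j = true ∧ rp v = basisRow j) := by
      simp only [ind, decide_eq_true_eq, Finset.mem_insert]
      constructor
      · rintro ⟨j, hj | hj, hr⟩
        · exact Or.inl (hj ▸ hr)
        · exact Or.inr ⟨j, hj, hr⟩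
      · rintro (hr | ⟨j, hj, hr⟩)
        · exact ⟨i, Or.inl rfl, hr⟩
        · exact ⟨j, Or.inr hj, hr⟩
    have hAB : ¬ (rp v = basisRow i ∧ ∃ j, ind T j = true ∧ rp v = basisRow j) := by
      rintro ⟨hr, j, hj, hr'⟩
      have hji : j = i := basisRow_inj (hr'.symm.trans hr)
      simp [ind] at hj
      exact hi (hji ▸ hj)
    have hrhs : decide (qp v = (fun _ => false) ∨ qp v = ind T ∨ qp v = basisRow i ∨
        qp v = ind (insert i T)) = true := by simp [hq]
    have e2 : decide (∃ j, basisRow i j = true ∧ rp v = basisRow j) = decide (rp v = basisRow i) :=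
      decide_eq_decide.2 hA
    have e3 : decide (∃ j, ind (insert i T) j = true ∧ rp v = basisRow j) =
        (decide (rp v = basisRow i) || decide (∃ j, ind T j = true ∧ rp v = basisRow j)) := by
      rw [← Bool.decide_or]; exact decide_eq_decide.2 hB
    rw [hrhs, e2, e3]
    have hAB' : ¬ (decide (rp v = basisRow i) = true ∧
        decide (∃ j, ind T j = true ∧ rp v = basisRow j) = true) := by
      simpa only [decide_eq_true_eq] using hAB
    revert hAB'
    generalize decide (rp v = basisRow i) = c
    generalize decide (∃ j, ind T j = true ∧ rp v = basisRow j) = b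
    cases c <;> cases b <;> simp
  · -- off the zero block: block indicators of three distinct rows
    rw [ldr_of_qp_ne_zero hq, ldr_of_qp_ne_zero hq, ldr_of_qp_ne_zero hq]
    by_cases h1 : qp v = ind T
    · have h2 : qp v ≠ basisRow i := fun h => hTi (h1.symm.trans h)
      have h3 : qp v ≠ ind (insert i T) := fun h => hTS (h1.symm.trans h)
      simp [h1, hTi, hTS]
    · by_cases h2 : qp v = basisRow i
      · have h3 : qp v ≠ ind (insert i T) := fun h => hiS (h2.symm.trans h)
        simp [h2, hiS, Ne.symm hTi]
      · by_cases h3 : qp v = ind (insert i T)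
        · simp [h3, Ne.symm hTS, Ne.symm hiS]
        · simp [hq, h1, h2, h3]

/-- The flat `{0, u_T, e_i, u_T+e_i} × R` is cut out by `n − 2` affine forms: with `k₁ ∈ T`,
`q_k = 0` for `k ∉ T ∪ {i}` and `q_l = q_{k₁}` for `l ∈ T ∖ {k₁}`. -/
theorem flat_eq {T : Finset (Fin n)} {k₁ : Fin n} (hk₁ : k₁ ∈ T) {i : Fin n} (hi : i ∉ T)
    (v : Fin (n + n) → Bool) :
    decide (qp v = (fun _ => false) ∨ qp v = ind T ∨ qp v = basisRow i ∨ qp v = ind (insert i T)) =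
      (decide (∀ k ∈ univ \ insert i T, v (Fin.castAdd n k) = false) &&
        decide (∀ l ∈ T.erase k₁, v (Fin.castAdd n l) = v (Fin.castAdd n k₁))) := by
  have hk₁i : k₁ ≠ i := fun e => hi (e ▸ hk₁)
  by_cases hU : qp v = (fun _ => false) ∨ qp v = ind T ∨ qp v = basisRow i ∨ qp v = ind (insert i T)
  · rw [decide_eq_true hU]
    symm
    rw [Bool.and_eq_true, decide_eq_true_eq, decide_eq_true_eq]
    refine ⟨fun k hk => ?_, fun l hl => ?_⟩
    · rw [Finset.mem_sdiff, Finset.mem_insert, not_or] at hk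
      obtain ⟨-, hki, hkT⟩ := hk
      change qp v k = false
      rcases hU with h | h | h | h <;> rw [h] <;> simp [ind, basisRow, hki, hkT]
    · obtain ⟨hlk, hlT⟩ := Finset.mem_erase.1 hl
      have hli : l ≠ i := fun e => hi (e ▸ hlT)
      change qp v l = qp v k₁
      rcases hU with h | h | h | h <;> rw [h] <;> simp [ind, basisRow, hlT, hk₁, hli, hk₁i]
  · rw [decide_eq_false hU]
    symm
    rw [Bool.eq_false_iff]
    intro hand
    rw [Bool.and_eq_true, decide_eq_true_eq, decide_eq_true_eq] at hand
    obtain ⟨hout, hin⟩ := hand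
    apply hU
    -- `q` is determined by `q_{k₁}` and `q_i`
    have key : ∀ k, qp v k = ((qp v k₁ && decide (k ∈ T)) || (qp v i && decide (k = i))) := by
      intro k
      by_cases hkT : k ∈ T
      · have hki : k ≠ i := fun e => hi (e ▸ hkT)
        by_cases hkk : k = k₁
        · subst hkk; simp [hkT, hki]
        · have := hin k (Finset.mem_erase.2 ⟨hkk, hkT⟩)
          change qp v k = qp v k₁ at this
          simp [hkT, hki, this]
      · by_cases hki : k = i
        · subst hki; simp [hkT]
        · have := hout k (by simp [hki, hkT])
          change qp v k = false at this
          simp [hkT, hki, this]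
    cases h1 : qp v k₁ <;> cases h2 : qp v i
    · left; funext k; rw [key k, h1, h2]; simp
    · right; right; left; funext k; rw [key k, h1, h2]; simp [basisRow]
    · right; left; funext k; rw [key k, h1, h2]; simp [ind]
    · right; right; right; funext k; rw [key k, h1, h2]
      by_cases hk : k = i <;> simp [ind, hk]

/-! ### Degrees -/

/-- A coordinate has degree `1`. -/
theorem hasDeg_coord {m : ℕ} (j : Fin m) : HasDeg (fun u : Fin m → Bool => u j) 1 := by
  unfold HasDeg
  have h : (fun x : Fin m → Bool => if x j = true then (1 : ZMod 2) else 0) = mono (ZMod 2) {j} := by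
    funext x; rw [mono_apply]; simp
  rw [h]
  exact mono_mem_lowDeg (by simp)

/-- Equality of two coordinates has degree `1` (`[a = b] = 1 + a + b`). -/
theorem hasDeg_coord_eq {m : ℕ} (a b : Fin m) : HasDeg (fun u : Fin m → Bool => decide (u a = u b)) 1 := by
  have h : (fun u : Fin m → Bool => decide (u a = u b)) = fun u => !(xor (u a) (u b)) := by
    funext u; cases u a <;> cases u b <;> rfl
  rw [h]
  exact hasDeg_not (hasDeg_xor (hasDeg_coord a) (hasDeg_coord b))

/-- A conjunction of `#F` conditions of degree `1` has degree `#F`. -/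
theorem hasDeg_forall {m : ℕ} {ι : Type*} [DecidableEq ι] (F : Finset ι) (g : ι → (Fin m → Bool) → Bool)
    (hg : ∀ j ∈ F, HasDeg (g j) 1) : HasDeg (fun u => decide (∀ j ∈ F, g j u = true)) F.card := by
  induction F using Finset.induction_on with
  | empty =>
    have h : (fun u : Fin m → Bool => decide (∀ j ∈ (∅ : Finset ι), g j u = true)) = fun _ => true := by
      funext u; simp
    rw [h, Finset.card_empty]; exact hasDeg_const true 0
  | insert a F ha ih =>
    have h : (fun u : Fin m → Bool => decide (∀ j ∈ insert a F, g j u = true)) =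
        fun u => g a u && decide (∀ j ∈ F, g j u = true) := by
      funext u; simp
    rw [h, Finset.card_insert_of_notMem ha, add_comm]
    exact hasDeg_and (hg a (Finset.mem_insert_self a F)) (ih fun j hj => hg j (Finset.mem_insert_of_mem hj))

/-- **The flat has degree `≤ n − 2`.** -/
theorem hasDeg_flat {T : Finset (Fin n)} (hT : T.Nonempty) {i : Fin n} (hi : i ∉ T) :
    HasDeg (fun v : Fin (n + n) → Bool =>
      decide (qp v = (fun _ => false) ∨ qp v = ind T ∨ qp v = basisRow i ∨ qp v = ind (insert i T)))
      (n - 2) := by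
  obtain ⟨k₁, hk₁⟩ := hT
  have hfun : (fun v : Fin (n + n) → Bool =>
      decide (qp v = (fun _ => false) ∨ qp v = ind T ∨ qp v = basisRow i ∨ qp v = ind (insert i T))) =
      fun v => (decide (∀ k ∈ univ \ insert i T, (!v (Fin.castAdd n k)) = true) &&
        decide (∀ l ∈ T.erase k₁, decide (v (Fin.castAdd n l) = v (Fin.castAdd n k₁)) = true)) := by
    funext v
    rw [flat_eq hk₁ hi]
    simp only [Bool.not_eq_true', decide_eq_true_eq]
  rw [hfun]
  have h1 := hasDeg_forall (univ \ insert i T) (fun k (v : Fin (n + n) → Bool) => !v (Fin.castAdd n k))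
    fun k _ => hasDeg_not (hasDeg_coord _)
  have h2 := hasDeg_forall (T.erase k₁)
    (fun l (v : Fin (n + n) → Bool) => decide (v (Fin.castAdd n l) = v (Fin.castAdd n k₁)))
    fun l _ => hasDeg_coord_eq _ _
  have hcard : (univ \ insert i T).card + (T.erase k₁).card = n - 2 := by
    rw [Finset.card_sdiff_of_subset (Finset.subset_univ _), Finset.card_univ, Fintype.card_fin,
      Finset.card_insert_of_notMem hi, Finset.card_erase_of_mem hk₁]
    have h1 : (insert i T).card ≤ n := (Finset.card_le_univ _).trans_eq (Fintype.card_fin n)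
    rw [Finset.card_insert_of_notMem hi] at h1
    have h2 : 1 ≤ T.card := Finset.card_pos.2 ⟨k₁, hk₁⟩
    omega
  rw [← hcard]
  convert hasDeg_and h1 h2 using 4

/-- **`RowsDeg (n − 2) Yf`**: every row of `Y` is a sum of flats. -/
theorem rowsDeg_Yf : RowsDeg (n - 2) (Yf (n := n)) := by
  classical
  have key : ∀ S : Finset (Fin n), HasDeg (fun v => Yf (ind S) v) (n - 2) := by
    intro S
    induction S using Finset.induction_on with
    | empty =>
      have h : (fun v : Fin (n + n) → Bool => Yf (ind ∅) v) = fun _ => false := by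
        funext v
        have : ind (∅ : Finset (Fin n)) = fun _ => false := (ind_eq_zero_iff ∅).2 rfl
        rw [Yf, this, ldr_zero, Xf]
        simp
      rw [h]; exact hasDeg_false _
    | insert i T hi ih =>
      rcases T.eq_empty_or_nonempty with rfl | hT
      · -- `Y(e_i) = a_{e_i} + a_{e_i} = 0`
        have h : (fun v : Fin (n + n) → Bool => Yf (ind {i}) v) = fun _ => false := by
          funext v
          rw [Yf, Xf_ind, ← Finset.insert_empty, CubeChar.subsetPar_insert (Finset.notMem_empty i),
            CubeChar.subsetPar_empty, Bool.xor_false]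
          have : ind (insert i (∅ : Finset (Fin n))) = basisRow i := by
            funext j; simp [ind, basisRow]
          rw [this, Bool.xor_self]
        rw [Finset.insert_empty, h]; exact hasDeg_false _
      · have h : (fun v : Fin (n + n) → Bool => Yf (ind (insert i T)) v) = fun v =>
            xor (Yf (ind T) v) (decide (qp v = (fun _ => false) ∨ qp v = ind T ∨
              qp v = basisRow i ∨ qp v = ind (insert i T))) := by
          funext v
          rw [← ldr_triangle hT hi, Yf, Yf, Xf_ind_insert hi]
          generalize ldr (basisRow i) v = p
          generalize Xf (ind T) v = q
          generalize ldr (ind T) v = s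
          generalize ldr (ind (insert i T)) v = t
          cases p <;> cases q <;> cases s <;> cases t <;> rfl
        rw [h]
        exact hasDeg_xor ih (hasDeg_flat hT hi)
  intro u
  have hu : u = ind (univ.filter fun j => u j = true) := by
    funext j; simp [ind]
  rw [hu]
  exact key _

/-- **`LinCols Xf`**: the columns of `X` are linear in the row index. -/
theorem linCols_Xf : LinCols (Xf (n := n)) := by
  refine ⟨fun v => ?_, fun v => ?_⟩
  · unfold Xf
    refine hasDeg_parity univ (fun j u => u j && ldr (basisRow j) v) fun j _ => ?_
    have h := hasDeg_and (hasDeg_coord (m := n) j) (hasDeg_const (L := n) (ldr (basisRow j) v) 0)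
    exact h
  · unfold Xf; simp

end TensorBlock

end Summit.QuantumAdvantage.AdviceFreeQNC0
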